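import Literature.NumberTheory.Rogawski1990.ArchSingularCentralizerLinkCoherence          -- C2 (this seat): the two one-step coherences, `monomialGL_mul`, the `(0 1)`-conjugator
import Literature.NumberTheory.Automorphic.CentralizerMeasureConjCoherence                 -- C1 (this seat): inner automorphisms act trivially; probability Haar measures correspond
import Literature.NumberTheory.Automorphic.ArchLocalSplitSingularCentralizerNoncompact     -- ★ p843001: noncompact-wall centralisers are not compact
import HarnessLib

/-!
# The pinned centraliser family at the wall points of ONE place is CONJUGATION-COHERENT (all conjugators, all pairs of points)
(Rogawski (1990) §8.2 pp. 122–124, §3.7 Prop. 3.7.1; Bröcker–tom Dieck IV (3.2); Deitmar–Echterhoff (2014) Thm. 1.5.3, Prop. 1.5.5)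

Topic `NumberTheory/Rogawski1990`; namespace `Literature.NumberTheory.Rogawski1990`.  THEOREMS ONLY (no definition, no instance, no notation, no named fact, no `sorry`).  Cell `pub/hodgecm-mathlib`,
crux H413 (`stmt-HodgeConjecture-24833`); (ST-∞) witness road (W1-coh) of census `CENSUS-E4b-SingularPinsBuilt` 1291225b; author F0P3-p03 (g10), 2026-09-01.  Count-neutral plumbing;
HONEST LABEL: HC_CM is proved only modulo the printed citations until rung 0 closes.

SETTING (★ p842366 (D5), σ-currency at a complex place `w`, frame `α`, wall point `z⁰`, reference wall point `z₁`): frame measures `ν_H τ` on `Z_{G_w(α∘τ)}(diag z₁)` LINKED by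
(T02)(T01) (★ p842975 `centralizer_measure_links_of_clause_neg_one` for the `(−1)`-pinned family), base measures `ρZ σ` on `Z_{G_w(α)}(p_σ)`, `p_σ = diag(z⁰∘σ)`: at noncompact `σ`
the transport `(e_{σ⁻¹}|_Z)_* ν_H(σ⁻¹)` (`hρZ` VERBATIM), at compact `σ` an inversion-invariant Haar measure of TOTAL MASS ONE.
MAIN **`centralizer_measure_family_conj_coherent`**: for all `σ₁ σ₂` and EVERY `g ∈ G_w(α)` with `g p_{σ₁} g⁻¹ = p_{σ₂}`: `(conj g|_Z)_* ρZ σ₁ = ρZ σ₂` — the `hcoh` binder of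
★ `IsQuotientOf.atPoint_eq_quotientMeasure_of_forall_map_conj_eq`, place by place.  Cases: compact∕compact — C1 (probability Haar measures correspond); mixed — impossible
(★ (C0) `isCompact_centralizer_circleDiagonal_comp_of_pos` vs ★ p843001 `not_compactSpace_centralizer_circleDiagonal_noncompactWall`, conjugate centralisers are homeomorphic);
noncompact∕noncompact — ★ `nc_closure_bool`: `σ₂ = word · σ₁` with the word a product of at most three `(0 2)`∕`(0 1)`-steps, each a C2 one-step coherence with an explicit conjugator
(`coh_step_swap02`, `coh_step_rescale01`, composed by `coh_trans`), and an arbitrary conjugator differs from the explicit one by an element of `Z(p_{σ₁})`, which acts trivially (C1).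

## References
* [Rogawski1990] J. D. Rogawski, *Automorphic Representations of Unitary Groups in Three Variables*, Ann. of Math. Stud. 123 (1990), §8.2 pp. 122–124; §3.7 Prop. 3.7.1.
* [BrockerTomDieck1985] T. Bröcker, T. tom Dieck, *Representations of Compact Lie Groups* (1985), IV (3.2).
* [DeitmarEchterhoff2014] A. Deitmar, S. Echterhoff, *Principles of Harmonic Analysis*, 2nd ed. (2014), Thm. 1.5.3, Prop. 1.5.5.
-/

set_option autoImplicit false

noncomputable section

open MeasureTheory Measure Filter Topology NumberField NumberField.InfinitePlace Matrix Equiv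
open Literature.MeasureTheory.Group Literature.NumberTheory.Automorphic Literature.NumberTheory.Automorphic.UnitaryGroup
open Literature.LinearAlgebra.Matrix
open scoped Matrix MatrixGroups Matrix.Norms.Operator NNReal ENNReal

namespace Literature.NumberTheory.Rogawski1990

section Coherence

variable (L : Type) [Field L] (α : Fin 3 → L) (w : {w : InfinitePlace L // IsComplex w})

/-! ## §1 The relation «conjugation-coherent along SOME conjugator» is transitive and upgrades to ALL conjugators -/

/-- Transitivity: coherence along `g₀ : p₁ ↦ p₂` and along `g₀′ : p₂ ↦ p₃` gives coherence along `g₀′g₀ : p₁ ↦ p₃` (`conj (g₀′g₀)|_Z = conj g₀′|_Z ∘ conj g₀|_Z`).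
[cite: DeitmarEchterhoff2014, Thm. 1.5.3] -/
theorem coh_trans [MeasurableSpace (GL (Fin 3) ℂ)] [BorelSpace (GL (Fin 3) ℂ)] {za zb zc : Fin 3 → Circle}
    (ρa : Measure (Subgroup.centralizer ({(⟨circleDiagonal 3 (za), circleDiagonal_mem_archLocal_diagonal L 3 α w (za)⟩ : archLocal L 3 (Matrix.diagonal α) w)} : Set (archLocal L 3 (Matrix.diagonal α) w)))) (ρb : Measure (Subgroup.centralizer ({(⟨circleDiagonal 3 (zb), circleDiagonal_mem_archLocal_diagonal L 3 α w (zb)⟩ : archLocal L 3 (Matrix.diagonal α) w)} : Set (archLocal L 3 (Matrix.diagonal α) w)))) (ρc : Measure (Subgroup.centralizer ({(⟨circleDiagonal 3 (zc), circleDiagonal_mem_archLocal_diagonal L 3 α w (zc)⟩ : archLocal L 3 (Matrix.diagonal α) w)} : Set (archLocal L 3 (Matrix.diagonal α) w))))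
    (hab : ∃ g₀ : archLocal L 3 (Matrix.diagonal α) w, ∃ hg₀ : (MulAut.conj g₀ : archLocal L 3 (Matrix.diagonal α) w ≃* archLocal L 3 (Matrix.diagonal α) w) (⟨circleDiagonal 3 (za), circleDiagonal_mem_archLocal_diagonal L 3 α w (za)⟩ : archLocal L 3 (Matrix.diagonal α) w) = (⟨circleDiagonal 3 (zb), circleDiagonal_mem_archLocal_diagonal L 3 α w (zb)⟩ : archLocal L 3 (Matrix.diagonal α) w),
      (ρa).map (subgroupCongrHomeomorph (MulAut.conj g₀ : archLocal L 3 (Matrix.diagonal α) w ≃* archLocal L 3 (Matrix.diagonal α) w) (Subgroup.centralizer ({(⟨circleDiagonal 3 (za), circleDiagonal_mem_archLocal_diagonal L 3 α w (za)⟩ : archLocal L 3 (Matrix.diagonal α) w)} : Set (archLocal L 3 (Matrix.diagonal α) w))) (Subgroup.centralizer ({(⟨circleDiagonal 3 (zb), circleDiagonal_mem_archLocal_diagonal L 3 α w (zb)⟩ : archLocal L 3 (Matrix.diagonal α) w)} : Set (archLocal L 3 (Matrix.diagonal α) w))) (forall_apply_mem_centralizer_singleton_iff_of_eq (MulAut.conj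 g₀ : archLocal L 3 (Matrix.diagonal α) w ≃* archLocal L 3 (Matrix.diagonal α) w) hg₀) (continuous_mulAutConj g₀) (continuous_mulAutConj_symm g₀)) = ρb)
    (hbc : ∃ g₀ : archLocal L 3 (Matrix.diagonal α) w, ∃ hg₀ : (MulAut.conj g₀ : archLocal L 3 (Matrix.diagonal α) w ≃* archLocal L 3 (Matrix.diagonal α) w) (⟨circleDiagonal 3 (zb), circleDiagonal_mem_archLocal_diagonal L 3 α w (zb)⟩ : archLocal L 3 (Matrix.diagonal α) w) = (⟨circleDiagonal 3 (zc), circleDiagonal_mem_archLocal_diagonal L 3 α w (zc)⟩ : archLocal L 3 (Matrix.diagonal α) w),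
      (ρb).map (subgroupCongrHomeomorph (MulAut.conj g₀ : archLocal L 3 (Matrix.diagonal α) w ≃* archLocal L 3 (Matrix.diagonal α) w) (Subgroup.centralizer ({(⟨circleDiagonal 3 (zb), circleDiagonal_mem_archLocal_diagonal L 3 α w (zb)⟩ : archLocal L 3 (Matrix.diagonal α) w)} : Set (archLocal L 3 (Matrix.diagonal α) w))) (Subgroup.centralizer ({(⟨circleDiagonal 3 (zc), circleDiagonal_mem_archLocal_diagonal L 3 α w (zc)⟩ : archLocal L 3 (Matrix.diagonal α) w)} : Set (archLocal L 3 (Matrix.diagonal α) w))) (forall_apply_mem_centralizer_singleton_iff_of_eq (MulAut.conj g₀ : archLocal L 3 (Matrix.diagonal α) w ≃* archLocal L 3 (Matrix.diagonal α) w) hg₀) (continuous_mulAutConj g₀) (continuous_mulAutConj_symm g₀)) = ρc) :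
    ∃ g₀ : archLocal L 3 (Matrix.diagonal α) w, ∃ hg₀ : (MulAut.conj g₀ : archLocal L 3 (Matrix.diagonal α) w ≃* archLocal L 3 (Matrix.diagonal α) w) (⟨circleDiagonal 3 (za), circleDiagonal_mem_archLocal_diagonal L 3 α w (za)⟩ : archLocal L 3 (Matrix.diagonal α) w) = (⟨circleDiagonal 3 (zc), circleDiagonal_mem_archLocal_diagonal L 3 α w (zc)⟩ : archLocal L 3 (Matrix.diagonal α) w),
      (ρa).map (subgroupCongrHomeomorph (MulAut.conj g₀ : archLocal L 3 (Matrix.diagonal α) w ≃* archLocal L 3 (Matrix.diagonal α) w) (Subgroup.centralizer ({(⟨circleDiagonal 3 (za), circleDiagonal_mem_archLocal_diagonal L 3 α w (za)⟩ : archLocal L 3 (Matrix.diagonal α) w)} : Set (archLocal L 3 (Matrix.diagonal α) w))) (Subgroup.centralizer ({(⟨circleDiagonal 3 (zc), circleDiagonal_mem_archLocal_diagonal L 3 α w (zc)⟩ : archLocal L 3 (Matrix.diagonal α) w)} : Set (archLocal L 3 (Matrix.diagonal α) w))) (forall_apply_mem_centralizer_singleton_iff_of_eq (MulAut.conj g₀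 : archLocal L 3 (Matrix.diagonal α) w ≃* archLocal L 3 (Matrix.diagonal α) w) hg₀) (continuous_mulAutConj g₀) (continuous_mulAutConj_symm g₀)) = ρc := by
  obtain ⟨g, hg, hab⟩ := hab
  obtain ⟨g', hg', hbc⟩ := hbc
  have hgg : (MulAut.conj (g' * g) : archLocal L 3 (Matrix.diagonal α) w ≃* archLocal L 3 (Matrix.diagonal α) w) (⟨circleDiagonal 3 (za), circleDiagonal_mem_archLocal_diagonal L 3 α w (za)⟩ : archLocal L 3 (Matrix.diagonal α) w) = (⟨circleDiagonal 3 (zc), circleDiagonal_mem_archLocal_diagonal L 3 α w (zc)⟩ : archLocal L 3 (Matrix.diagonal α) w) := by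
    rw [map_mul, MulAut.mul_apply, hg, hg']
  refine ⟨g' * g, hgg, ?_⟩
  rw [← hbc, ← hab, Measure.map_map (Homeomorph.measurable _) (Homeomorph.measurable _)]
  congr 1
  funext x
  apply Subtype.ext
  apply Subtype.ext
  simp only [Function.comp_apply, coe_subgroupCongrHomeomorph_apply, MulAut.conj_apply, Subgroup.coe_mul, Subgroup.coe_inv, _root_.mul_inv_rev, mul_assoc]

/-- **ONE CONJUGATOR SUFFICES**: if an inversion-invariant Haar measure `ρ₁` on `Z(p₁)` is carried to `ρ₂` by SOME conjugator `g₀ : p₁ ↦ p₂`, it is carried to `ρ₂` by EVERY conjugator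
`g : p₁ ↦ p₂` — `g = g₀ζ` with `ζ = g₀⁻¹g ∈ Z(p₁)`, and `conj ζ|_Z` fixes the two-sided `ρ₁` (C1 `map_subgroupCongrHomeomorph_conj_eq_self_of_mem`).
[cite: DeitmarEchterhoff2014, Prop. 1.5.5] -/
theorem coh_of_exists [MeasurableSpace (GL (Fin 3) ℂ)] [BorelSpace (GL (Fin 3) ℂ)] {za zb : Fin 3 → Circle}
    (ρa : Measure (Subgroup.centralizer ({(⟨circleDiagonal 3 (za), circleDiagonal_mem_archLocal_diagonal L 3 α w (za)⟩ : archLocal L 3 (Matrix.diagonal α) w)} : Set (archLocal L 3 (Matrix.diagonal α) w)))) [iah : ρa.IsHaarMeasure] [iai : ρa.IsInvInvariant] (ρb : Measure (Subgroup.centralizer ({(⟨circleDiagonal 3 (zb), circleDiagonal_mem_archLocal_diagonal L 3 α w (zb)⟩ : archLocal L 3 (Matrix.diagonal α) w)} : Set (archLocal L 3 (Matrix.diagonal α) w))))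
    (h : ∃ g₀ : archLocal L 3 (Matrix.diagonal α) w, ∃ hg₀ : (MulAut.conj g₀ : archLocal L 3 (Matrix.diagonal α) w ≃* archLocal L 3 (Matrix.diagonal α) w) (⟨circleDiagonal 3 (za), circleDiagonal_mem_archLocal_diagonal L 3 α w (za)⟩ : archLocal L 3 (Matrix.diagonal α) w) = (⟨circleDiagonal 3 (zb), circleDiagonal_mem_archLocal_diagonal L 3 α w (zb)⟩ : archLocal L 3 (Matrix.diagonal α) w),
      (ρa).map (subgroupCongrHomeomorph (MulAut.conj g₀ : archLocal L 3 (Matrix.diagonal α) w ≃* archLocal L 3 (Matrix.diagonal α) w) (Subgroup.centralizer ({(⟨circleDiagonal 3 (za), circleDiagonal_mem_archLocal_diagonal L 3 α w (za)⟩ : archLocal L 3 (Matrix.diagonal α) w)} : Set (archLocal L 3 (Matrix.diagonal α) w))) (Subgroup.centralizer ({(⟨circleDiagonal 3 (zb), circleDiagonal_mem_archLocal_diagonal L 3 α w (zb)⟩ : archLocal L 3 (Matrix.diagonal α) w)} : Set (archLocal L 3 (Matrix.diagonal α) w))) (forall_apply_mem_centralizer_singleton_iff_of_eq (MulAut.conj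 g₀ : archLocal L 3 (Matrix.diagonal α) w ≃* archLocal L 3 (Matrix.diagonal α) w) hg₀) (continuous_mulAutConj g₀) (continuous_mulAutConj_symm g₀)) = ρb)
    (g : archLocal L 3 (Matrix.diagonal α) w) (hg : (MulAut.conj g : archLocal L 3 (Matrix.diagonal α) w ≃* archLocal L 3 (Matrix.diagonal α) w) (⟨circleDiagonal 3 (za), circleDiagonal_mem_archLocal_diagonal L 3 α w (za)⟩ : archLocal L 3 (Matrix.diagonal α) w) = (⟨circleDiagonal 3 (zb), circleDiagonal_mem_archLocal_diagonal L 3 α w (zb)⟩ : archLocal L 3 (Matrix.diagonal α) w)) :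
    ρa.map (subgroupCongrHomeomorph (MulAut.conj g : archLocal L 3 (Matrix.diagonal α) w ≃* archLocal L 3 (Matrix.diagonal α) w) (Subgroup.centralizer ({(⟨circleDiagonal 3 (za), circleDiagonal_mem_archLocal_diagonal L 3 α w (za)⟩ : archLocal L 3 (Matrix.diagonal α) w)} : Set (archLocal L 3 (Matrix.diagonal α) w))) (Subgroup.centralizer ({(⟨circleDiagonal 3 (zb), circleDiagonal_mem_archLocal_diagonal L 3 α w (zb)⟩ : archLocal L 3 (Matrix.diagonal α) w)} : Set (archLocal L 3 (Matrix.diagonal α) w))) (forall_apply_mem_centralizer_singleton_iff_of_eq (MulAut.conj g : archLocal L 3 (Matrix.diagonal α) w ≃* archLocal L 3 (Matrix.diagonal α) w) hg) (continuous_mulAutConj g) (continuous_mulAutConj_symm g)) = ρb := by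
  obtain ⟨g₀, hg₀, he⟩ := h
  haveI : ρa.IsMulRightInvariant := isMulRightInvariant_of_isInvInvariant ρa
  -- `ζ = g₀⁻¹ g` centralises `p₁`
  have hζ : (MulAut.conj (g₀⁻¹ * g) : archLocal L 3 (Matrix.diagonal α) w ≃* archLocal L 3 (Matrix.diagonal α) w) (⟨circleDiagonal 3 (za), circleDiagonal_mem_archLocal_diagonal L 3 α w (za)⟩ : archLocal L 3 (Matrix.diagonal α) w) = (⟨circleDiagonal 3 (za), circleDiagonal_mem_archLocal_diagonal L 3 α w (za)⟩ : archLocal L 3 (Matrix.diagonal α) w) := by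
    rw [map_mul, MulAut.mul_apply, hg, ← hg₀, ← MulAut.mul_apply, ← map_mul, inv_mul_cancel, map_one, MulAut.one_apply]
  have hζmem : g₀⁻¹ * g ∈ Subgroup.centralizer ({(⟨circleDiagonal 3 (za), circleDiagonal_mem_archLocal_diagonal L 3 α w (za)⟩ : archLocal L 3 (Matrix.diagonal α) w)} : Set (archLocal L 3 (Matrix.diagonal α) w)) := by
    rw [Subgroup.mem_centralizer_singleton_iff]
    have h := hζ
    rw [MulAut.conj_apply] at h
    -- h : g₀⁻¹ * g * p * (g₀⁻¹ * g)⁻¹ = p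
    calc g₀⁻¹ * g * (⟨circleDiagonal 3 (za), circleDiagonal_mem_archLocal_diagonal L 3 α w (za)⟩ : archLocal L 3 (Matrix.diagonal α) w)
        = g₀⁻¹ * g * (⟨circleDiagonal 3 (za), circleDiagonal_mem_archLocal_diagonal L 3 α w (za)⟩ : archLocal L 3 (Matrix.diagonal α) w) * (g₀⁻¹ * g)⁻¹ * (g₀⁻¹ * g) := by group
      _ = (⟨circleDiagonal 3 (za), circleDiagonal_mem_archLocal_diagonal L 3 α w (za)⟩ : archLocal L 3 (Matrix.diagonal α) w) * (g₀⁻¹ * g) := by rw [h]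
  -- `conj g = conj g₀ ∘ conj ζ` on `Z(p₁)`
  have hfun : (⇑(subgroupCongrHomeomorph (MulAut.conj g : archLocal L 3 (Matrix.diagonal α) w ≃* archLocal L 3 (Matrix.diagonal α) w) (Subgroup.centralizer ({(⟨circleDiagonal 3 (za), circleDiagonal_mem_archLocal_diagonal L 3 α w (za)⟩ : archLocal L 3 (Matrix.diagonal α) w)} : Set (archLocal L 3 (Matrix.diagonal α) w))) (Subgroup.centralizer ({(⟨circleDiagonal 3 (zb), circleDiagonal_mem_archLocal_diagonal L 3 α w (zb)⟩ : archLocal L 3 (Matrix.diagonal α) w)} : Set (archLocal L 3 (Matrix.diagonal α) w))) (forall_apply_mem_centralizer_singleton_iff_of_eq (MulAut.conj g : archLocal L 3 (Matrix.diagonal α) w ≃* archLocal L 3 (Matrix.diagonal α) w) hg) (continuous_mulAutConj g) (continuous_mulAutConj_symm g)) : Subgroup.centralizer ({(⟨circleDiagonal 3 (za), circleDiagonal_mem_archLocal_diagonal L 3 α w (za)⟩ : archLocal L 3 (Matrix.diagonal α) w)} : Set (archLocal L 3 (Matrix.diagonal α) w)) → Subgroup.centralizer ({(⟨circleDiagonal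 3 (zb), circleDiagonal_mem_archLocal_diagonal L 3 α w (zb)⟩ : archLocal L 3 (Matrix.diagonal α) w)} : Set (archLocal L 3 (Matrix.diagonal α) w))) =
      ⇑(subgroupCongrHomeomorph (MulAut.conj g₀ : archLocal L 3 (Matrix.diagonal α) w ≃* archLocal L 3 (Matrix.diagonal α) w) (Subgroup.centralizer ({(⟨circleDiagonal 3 (za), circleDiagonal_mem_archLocal_diagonal L 3 α w (za)⟩ : archLocal L 3 (Matrix.diagonal α) w)} : Set (archLocal L 3 (Matrix.diagonal α) w))) (Subgroup.centralizer ({(⟨circleDiagonal 3 (zb), circleDiagonal_mem_archLocal_diagonal L 3 α w (zb)⟩ : archLocal L 3 (Matrix.diagonal α) w)} : Set (archLocal L 3 (Matrix.diagonal α) w))) (forall_apply_mem_centralizer_singleton_iff_of_eq (MulAut.conj g₀ : archLocal L 3 (Matrix.diagonal α) w ≃* archLocal L 3 (Matrix.diagonal α) w) hg₀) (continuous_mulAutConj g₀) (continuous_mulAutConj_symm g₀)) ∘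
      ⇑(subgroupCongrHomeomorph (MulAut.conj (g₀⁻¹ * g) : archLocal L 3 (Matrix.diagonal α) w ≃* archLocal L 3 (Matrix.diagonal α) w) (Subgroup.centralizer ({(⟨circleDiagonal 3 (za), circleDiagonal_mem_archLocal_diagonal L 3 α w (za)⟩ : archLocal L 3 (Matrix.diagonal α) w)} : Set (archLocal L 3 (Matrix.diagonal α) w))) (Subgroup.centralizer ({(⟨circleDiagonal 3 (za), circleDiagonal_mem_archLocal_diagonal L 3 α w (za)⟩ : archLocal L 3 (Matrix.diagonal α) w)} : Set (archLocal L 3 (Matrix.diagonal α) w))) (forall_apply_mem_centralizer_singleton_iff_of_eq (MulAut.conj (g₀⁻¹ * g) : archLocal L 3 (Matrix.diagonal α) w ≃* archLocal L 3 (Matrix.diagonal α) w) hζ) (continuous_mulAutConj (g₀⁻¹ * g)) (continuous_mulAutConj_symm (g₀⁻¹ * g))) := by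
    funext x
    apply Subtype.ext
    apply Subtype.ext
    simp only [Function.comp_apply, coe_subgroupCongrHomeomorph_apply, MulAut.conj_apply, Subgroup.coe_mul, Subgroup.coe_inv, _root_.mul_inv_rev, inv_inv, mul_assoc,
      mul_inv_cancel, mul_one, mul_inv_cancel_left]
  rw [hfun, ← Measure.map_map (Homeomorph.measurable _) (Homeomorph.measurable _),
    map_subgroupCongrHomeomorph_conj_eq_self_of_mem (Subgroup.centralizer ({(⟨circleDiagonal 3 (za), circleDiagonal_mem_archLocal_diagonal L 3 α w (za)⟩ : archLocal L 3 (Matrix.diagonal α) w)} : Set (archLocal L 3 (Matrix.diagonal α) w))) (g₀⁻¹ * g) hζmem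
      (forall_apply_mem_centralizer_singleton_iff_of_eq (MulAut.conj (g₀⁻¹ * g) : archLocal L 3 (Matrix.diagonal α) w ≃* archLocal L 3 (Matrix.diagonal α) w) hζ) ρa, he]

/-! ## §2 The two one-step coherences as instances of the relation -/

/-- The `(0 2)`-step (C2 `centralizer_measure_base_eq_of_swap02`) as an instance of the relation, for the linked family. [cite: Rogawski1990, §8.2 pp. 122–124] -/
theorem coh_step_swap02
    [MeasurableSpace (GL (Fin 3) ℂ)] [BorelSpace (GL (Fin 3) ℂ)]
    {z₁ z0 : Fin 3 → Circle} (h02 : z₁ 0 = z₁ 2) (h01 : z₁ 0 ≠ z₁ 1) (h02' : z0 0 = z0 2) (h01' : z0 0 ≠ z0 1)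
    (νH : ∀ τ : Perm (Fin 3), Measure (Subgroup.centralizer ({(⟨circleDiagonal 3 z₁, circleDiagonal_mem_archLocal_diagonal L 3 (α ∘ ⇑τ) w z₁⟩ : archLocal L 3 (Matrix.diagonal (α ∘ ⇑τ)) w)} : Set (archLocal L 3 (Matrix.diagonal (α ∘ ⇑τ)) w))))
    (hT02 : ∀ (τ : Perm (Fin 3)), (w.1.embedding (α (τ 0))).re * (w.1.embedding (α (τ 2))).re < 0 →
      νH τ = (νH (τ * Equiv.swap (0 : Fin 3) 2)).map (subgroupCongrHomeomorph (ContinuousMulEquiv.restrictSubgroup (GLn.conjEquiv (Matrix.GeneralLinearGroup.mkOfDetNeZero _ (det_monomial_one_ne_zero 3 (Equiv.swap (0 : Fin 3) 2)))) (archLocal L 3 (Matrix.diagonal ((α ∘ ⇑τ) ∘ ⇑(Equiv.swap (0 : Fin 3) 2))) w) (archLocal L 3 (Matrix.diagonal (α ∘ ⇑τ)) w) (mem_archLocal_comp_perm_iff_conj_mem L 3 (α ∘ ⇑τ) w (Equiv.swap (0 : Fin 3) 2))).toMulEquiv (Subgroup.centralizer ({(⟨circleDiagonal 3 z₁, circleDiagonal_mem_archLocal_diagonal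 L 3 ((α ∘ ⇑τ) ∘ ⇑(Equiv.swap (0 : Fin 3) 2)) w z₁⟩ : archLocal L 3 (Matrix.diagonal ((α ∘ ⇑τ) ∘ ⇑(Equiv.swap (0 : Fin 3) 2))) w)} : Set (archLocal L 3 (Matrix.diagonal ((α ∘ ⇑τ) ∘ ⇑(Equiv.swap (0 : Fin 3) 2))) w))) (Subgroup.centralizer ({(⟨circleDiagonal 3 z₁, circleDiagonal_mem_archLocal_diagonal L 3 (α ∘ ⇑τ) w z₁⟩ : archLocal L 3 (Matrix.diagonal (α ∘ ⇑τ)) w)} : Set (archLocal L 3 (Matrix.diagonal (α ∘ ⇑τ)) w))) (forall_apply_mem_centralizer_singleton_iff_of_eq (ContinuousMulEquiv.restrictSubgroup (GLn.conjEquiv (Matrix.GeneralLinearGroup.mkOfDetNeZero _ (det_monomial_one_ne_zero 3 (Equiv.swap (0 : Fin 3) 2)))) (archLocal L 3 (Matrix.diagonal ((α ∘ ⇑τ) ∘ ⇑(Equiv.swap (0 : Fin 3) 2))) w) (archLocal L 3 (Matrix.diagonal (α ∘ ⇑τ)) w) (mem_archLocal_comp_perm_iff_conj_mem L 3 (α ∘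 ⇑τ) w (Equiv.swap (0 : Fin 3) 2))).toMulEquiv ((relabel_circleDiagonal L 3 (α ∘ ⇑τ) w (Equiv.swap (0 : Fin 3) 2) z₁).trans (Subtype.ext (congrArg (circleDiagonal 3) (comp_swap02_symm_eq_self_of_wall z₁ h02))))) (ContinuousMulEquiv.restrictSubgroup (GLn.conjEquiv (Matrix.GeneralLinearGroup.mkOfDetNeZero _ (det_monomial_one_ne_zero 3 (Equiv.swap (0 : Fin 3) 2)))) (archLocal L 3 (Matrix.diagonal ((α ∘ ⇑τ) ∘ ⇑(Equiv.swap (0 : Fin 3) 2))) w) (archLocal L 3 (Matrix.diagonal (α ∘ ⇑τ)) w) (mem_archLocal_comp_perm_iff_conj_mem L 3 (α ∘ ⇑τ) w (Equiv.swap (0 : Fin 3) 2))).continuous (ContinuousMulEquiv.restrictSubgroup (GLn.conjEquiv (Matrix.GeneralLinearGroup.mkOfDetNeZero _ (det_monomial_one_ne_zero 3 (Equiv.swap (0 : Fin 3) 2)))) (archLocal L 3 (Matrix.diagonal ((α ∘ ⇑τ) ∘ ⇑(Equiv.swap (0 : Fin 3) 2))) w) (archLocal L 3 (Matrix.diagonal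 (α ∘ ⇑τ)) w) (mem_archLocal_comp_perm_iff_conj_mem L 3 (α ∘ ⇑τ) w (Equiv.swap (0 : Fin 3) 2))).symm.continuous))
    (ρZ : ∀ σ : Perm (Fin 3), Measure (Subgroup.centralizer ({(⟨circleDiagonal 3 (z0 ∘ ⇑σ), circleDiagonal_mem_archLocal_diagonal L 3 α w (z0 ∘ ⇑σ)⟩ : archLocal L 3 (Matrix.diagonal α) w)} : Set (archLocal L 3 (Matrix.diagonal α) w))))
    (hρZ : ∀ (σ : Perm (Fin 3)), ¬ 0 < (w.1.embedding (α (σ⁻¹ 0))).re * (w.1.embedding (α (σ⁻¹ 2))).re →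
      ρZ σ = (νH σ⁻¹).map (subgroupCongrHomeomorph (ContinuousMulEquiv.restrictSubgroup (GLn.conjEquiv (Matrix.GeneralLinearGroup.mkOfDetNeZero _ (det_monomial_one_ne_zero 3 σ⁻¹))) (archLocal L 3 (Matrix.diagonal (α ∘ ⇑σ⁻¹)) w) (archLocal L 3 (Matrix.diagonal α) w) (mem_archLocal_comp_perm_iff_conj_mem L 3 α w σ⁻¹)).toMulEquiv (Subgroup.centralizer ({(⟨circleDiagonal 3 z₁, circleDiagonal_mem_archLocal_diagonal L 3 (α ∘ ⇑σ⁻¹) w z₁⟩ : archLocal L 3 (Matrix.diagonal (α ∘ ⇑σ⁻¹)) w)} : Set (archLocal L 3 (Matrix.diagonal (α ∘ ⇑σ⁻¹)) w))) (Subgroup.centralizer ({(⟨circleDiagonal 3 (z0 ∘ ⇑σ), circleDiagonal_mem_archLocal_diagonal L 3 α w (z0 ∘ ⇑σ)⟩ : archLocal L 3 (Matrix.diagonal α) w)} : Set (archLocal L 3 (Matrix.diagonal α) w))) (relabel_inv_mem_centralizer_circleDiagonal_comp_iff L α w σ h02 h01 h02' h01') (ContinuousMulEquiv.restrictSubgroup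 (GLn.conjEquiv (Matrix.GeneralLinearGroup.mkOfDetNeZero _ (det_monomial_one_ne_zero 3 σ⁻¹))) (archLocal L 3 (Matrix.diagonal (α ∘ ⇑σ⁻¹)) w) (archLocal L 3 (Matrix.diagonal α) w) (mem_archLocal_comp_perm_iff_conj_mem L 3 α w σ⁻¹)).continuous (ContinuousMulEquiv.restrictSubgroup (GLn.conjEquiv (Matrix.GeneralLinearGroup.mkOfDetNeZero _ (det_monomial_one_ne_zero 3 σ⁻¹))) (archLocal L 3 (Matrix.diagonal (α ∘ ⇑σ⁻¹)) w) (archLocal L 3 (Matrix.diagonal α) w) (mem_archLocal_comp_perm_iff_conj_mem L 3 α w σ⁻¹)).symm.continuous))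
    (σ : Perm (Fin 3)) (hnc : (w.1.embedding (α (σ⁻¹ 0))).re * (w.1.embedding (α (σ⁻¹ 2))).re < 0) :
    ∃ g₀ : archLocal L 3 (Matrix.diagonal α) w, ∃ hg₀ : (MulAut.conj g₀ : archLocal L 3 (Matrix.diagonal α) w ≃* archLocal L 3 (Matrix.diagonal α) w) (⟨circleDiagonal 3 (z0 ∘ ⇑σ), circleDiagonal_mem_archLocal_diagonal L 3 α w (z0 ∘ ⇑σ)⟩ : archLocal L 3 (Matrix.diagonal α) w) = (⟨circleDiagonal 3 (z0 ∘ ⇑((Equiv.swap (0 : Fin 3) 2) * σ)), circleDiagonal_mem_archLocal_diagonal L 3 α w (z0 ∘ ⇑((Equiv.swap (0 : Fin 3) 2) * σ))⟩ : archLocal L 3 (Matrix.diagonal α) w),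
      (ρZ σ).map (subgroupCongrHomeomorph (MulAut.conj g₀ : archLocal L 3 (Matrix.diagonal α) w ≃* archLocal L 3 (Matrix.diagonal α) w) (Subgroup.centralizer ({(⟨circleDiagonal 3 (z0 ∘ ⇑σ), circleDiagonal_mem_archLocal_diagonal L 3 α w (z0 ∘ ⇑σ)⟩ : archLocal L 3 (Matrix.diagonal α) w)} : Set (archLocal L 3 (Matrix.diagonal α) w))) (Subgroup.centralizer ({(⟨circleDiagonal 3 (z0 ∘ ⇑((Equiv.swap (0 : Fin 3) 2) * σ)), circleDiagonal_mem_archLocal_diagonal L 3 α w (z0 ∘ ⇑((Equiv.swap (0 : Fin 3) 2) * σ))⟩ : archLocal L 3 (Matrix.diagonal α) w)} : Set (archLocal L 3 (Matrix.diagonal α) w))) (forall_apply_mem_centralizer_singleton_iff_of_eq (MulAut.conj g₀ : archLocal L 3 (Matrix.diagonal α) w ≃* archLocal L 3 (Matrix.diagonal α) w) hg₀) (continuous_mulAutConj g₀) (continuous_mulAutConj_symm g₀)) = ρZ ((Equiv.swap (0 : Fin 3) 2) * σ) := by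
  have hncw : ¬ 0 < (w.1.embedding (α (σ⁻¹ 0))).re * (w.1.embedding (α (σ⁻¹ 2))).re := fun h => (lt_asymm hnc) h
  have e0 : ((Equiv.swap (0 : Fin 3) 2) * σ)⁻¹ 0 = σ⁻¹ 2 := by rw [Equiv.Perm.inv_eq_iff_eq]; simp
  have e2 : ((Equiv.swap (0 : Fin 3) 2) * σ)⁻¹ 2 = σ⁻¹ 0 := by rw [Equiv.Perm.inv_eq_iff_eq]; simp
  have hncw' : ¬ 0 < (w.1.embedding (α (((Equiv.swap (0 : Fin 3) 2) * σ)⁻¹ 0))).re * (w.1.embedding (α (((Equiv.swap (0 : Fin 3) 2) * σ)⁻¹ 2))).re := by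
    rw [e0, e2, mul_comm]; exact fun h => (lt_asymm hnc) h
  refine ⟨1, conj_one_circleDiagonal_comp_eq_comp_swap02_mul L α w σ h02', ?_⟩
  exact centralizer_measure_base_eq_of_swap02 L α w σ h02 h01 h02' h01' (νH σ⁻¹) (νH ((Equiv.swap (0 : Fin 3) 2) * σ)⁻¹) (hT02 σ⁻¹ hnc)
    (ρZ σ) (hρZ σ hncw) (ρZ ((Equiv.swap (0 : Fin 3) 2) * σ)) (hρZ ((Equiv.swap (0 : Fin 3) 2) * σ) hncw')

/-- The `(0 1)`-step (C2 `centralizer_measure_base_eq_of_rescale01`) as an instance of the relation, for the linked family (`re σ_wα_{σ⁻¹0}·re σ_wα_{σ⁻¹1} > 0`).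
[cite: Rogawski1990, §8.2 pp. 122–124] -/
theorem coh_step_rescale01
    (hreal : ∀ i, (w.1.embedding (α i)).im = 0)
    [MeasurableSpace (GL (Fin 3) ℂ)] [BorelSpace (GL (Fin 3) ℂ)]
    {z₁ z0 : Fin 3 → Circle} (h02 : z₁ 0 = z₁ 2) (h01 : z₁ 0 ≠ z₁ 1) (h02' : z0 0 = z0 2) (h01' : z0 0 ≠ z0 1)
    (νH : ∀ τ : Perm (Fin 3), Measure (Subgroup.centralizer ({(⟨circleDiagonal 3 z₁, circleDiagonal_mem_archLocal_diagonal L 3 (α ∘ ⇑τ) w z₁⟩ : archLocal L 3 (Matrix.diagonal (α ∘ ⇑τ)) w)} : Set (archLocal L 3 (Matrix.diagonal (α ∘ ⇑τ)) w))))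
    (hT01 : ∀ (τ : Perm (Fin 3)), (w.1.embedding (α (τ 0))).re * (w.1.embedding (α (τ 2))).re < 0 →
      ∀ (h01s : 0 < (w.1.embedding ((α ∘ ⇑τ) 0)).re * (w.1.embedding ((α ∘ ⇑τ) 1)).re),
      νH (τ * Equiv.swap (0 : Fin 3) 1) = (νH τ).map (subgroupCongrHomeomorph (ContinuousMulEquiv.restrictSubgroup (GLn.conjEquiv (Matrix.GeneralLinearGroup.mkOfDetNeZero (Matrix.diagonal ![((Real.sqrt ((w.1.embedding ((α ∘ ⇑τ) 0)).re / (w.1.embedding ((α ∘ ⇑τ) 1)).re) : ℝ) : ℂ), ((Real.sqrt ((w.1.embedding ((α ∘ ⇑τ) 1)).re / (w.1.embedding ((α ∘ ⇑τ) 0)).re) : ℝ) : ℂ), 1]) (det_rescale01_ne_zero h01s))) (archLocal L 3 (Matrix.diagonal (α ∘ ⇑τ)) w) (archLocal L 3 (Matrix.diagonal ((α ∘ ⇑τ) ∘ ⇑(Equiv.swap (0 : Fin 3) 1))) w) (mem_archLocal_diagonal_iff_conjEquiv_mem_of_formCongr_eq L 3 (α ∘ ⇑τ) ((α ∘ ⇑τ)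 ∘ ⇑(Equiv.swap (0 : Fin 3) 1)) w (Matrix.GeneralLinearGroup.mkOfDetNeZero (Matrix.diagonal ![((Real.sqrt ((w.1.embedding ((α ∘ ⇑τ) 0)).re / (w.1.embedding ((α ∘ ⇑τ) 1)).re) : ℝ) : ℂ), ((Real.sqrt ((w.1.embedding ((α ∘ ⇑τ) 1)).re / (w.1.embedding ((α ∘ ⇑τ) 0)).re) : ℝ) : ℂ), 1]) (det_rescale01_ne_zero h01s)) (formCongr_rescale01_map_diagonal L (α ∘ ⇑τ) w (fun i => hreal (τ i)) h01s))).toMulEquiv (Subgroup.centralizer ({(⟨circleDiagonal 3 z₁, circleDiagonal_mem_archLocal_diagonal L 3 (α ∘ ⇑τ) w z₁⟩ : archLocal L 3 (Matrix.diagonal (α ∘ ⇑τ)) w)} : Set (archLocal L 3 (Matrix.diagonal (α ∘ ⇑τ)) w))) (Subgroup.centralizer ({(⟨circleDiagonal 3 z₁, circleDiagonal_mem_archLocal_diagonal L 3 ((α ∘ ⇑τ) ∘ ⇑(Equiv.swap (0 : Fin 3) 1)) w z₁⟩ : archLocal L 3 (Matrix.diagonal ((α ∘ ⇑τ) ∘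 ⇑(Equiv.swap (0 : Fin 3) 1))) w)} : Set (archLocal L 3 (Matrix.diagonal ((α ∘ ⇑τ) ∘ ⇑(Equiv.swap (0 : Fin 3) 1))) w))) (forall_apply_mem_centralizer_singleton_iff_of_eq (ContinuousMulEquiv.restrictSubgroup (GLn.conjEquiv (Matrix.GeneralLinearGroup.mkOfDetNeZero (Matrix.diagonal ![((Real.sqrt ((w.1.embedding ((α ∘ ⇑τ) 0)).re / (w.1.embedding ((α ∘ ⇑τ) 1)).re) : ℝ) : ℂ), ((Real.sqrt ((w.1.embedding ((α ∘ ⇑τ) 1)).re / (w.1.embedding ((α ∘ ⇑τ) 0)).re) : ℝ) : ℂ), 1]) (det_rescale01_ne_zero h01s))) (archLocal L 3 (Matrix.diagonal (α ∘ ⇑τ)) w) (archLocal L 3 (Matrix.diagonal ((α ∘ ⇑τ) ∘ ⇑(Equiv.swap (0 : Fin 3) 1))) w) (mem_archLocal_diagonal_iff_conjEquiv_mem_of_formCongr_eq L 3 (α ∘ ⇑τ) ((α ∘ ⇑τ) ∘ ⇑(Equiv.swap (0 : Fin 3) 1)) w (Matrix.GeneralLinearGroup.mkOfDetNeZero (Matrix.diagonal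 ![((Real.sqrt ((w.1.embedding ((α ∘ ⇑τ) 0)).re / (w.1.embedding ((α ∘ ⇑τ) 1)).re) : ℝ) : ℂ), ((Real.sqrt ((w.1.embedding ((α ∘ ⇑τ) 1)).re / (w.1.embedding ((α ∘ ⇑τ) 0)).re) : ℝ) : ℂ), 1]) (det_rescale01_ne_zero h01s)) (formCongr_rescale01_map_diagonal L (α ∘ ⇑τ) w (fun i => hreal (τ i)) h01s))).toMulEquiv (congrT_circleDiagonal L 3 (α ∘ ⇑τ) ((α ∘ ⇑τ) ∘ ⇑(Equiv.swap (0 : Fin 3) 1)) w (Matrix.GeneralLinearGroup.mkOfDetNeZero (Matrix.diagonal ![((Real.sqrt ((w.1.embedding ((α ∘ ⇑τ) 0)).re / (w.1.embedding ((α ∘ ⇑τ) 1)).re) : ℝ) : ℂ), ((Real.sqrt ((w.1.embedding ((α ∘ ⇑τ) 1)).re / (w.1.embedding ((α ∘ ⇑τ) 0)).re) : ℝ) : ℂ), 1]) (det_rescale01_ne_zero h01s)) (formCongr_rescale01_map_diagonal L (α ∘ ⇑τ) w (fun i => hreal (τ i)) h01s) (rescale01_conj_circleDiagonal L (α ∘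 ⇑τ) w h01s) z₁)) (ContinuousMulEquiv.restrictSubgroup (GLn.conjEquiv (Matrix.GeneralLinearGroup.mkOfDetNeZero (Matrix.diagonal ![((Real.sqrt ((w.1.embedding ((α ∘ ⇑τ) 0)).re / (w.1.embedding ((α ∘ ⇑τ) 1)).re) : ℝ) : ℂ), ((Real.sqrt ((w.1.embedding ((α ∘ ⇑τ) 1)).re / (w.1.embedding ((α ∘ ⇑τ) 0)).re) : ℝ) : ℂ), 1]) (det_rescale01_ne_zero h01s))) (archLocal L 3 (Matrix.diagonal (α ∘ ⇑τ)) w) (archLocal L 3 (Matrix.diagonal ((α ∘ ⇑τ) ∘ ⇑(Equiv.swap (0 : Fin 3) 1))) w) (mem_archLocal_diagonal_iff_conjEquiv_mem_of_formCongr_eq L 3 (α ∘ ⇑τ) ((α ∘ ⇑τ) ∘ ⇑(Equiv.swap (0 : Fin 3) 1)) w (Matrix.GeneralLinearGroup.mkOfDetNeZero (Matrix.diagonal ![((Real.sqrt ((w.1.embedding ((α ∘ ⇑τ) 0)).re / (w.1.embedding ((α ∘ ⇑τ) 1)).re) : ℝ) : ℂ), ((Real.sqrt ((w.1.embedding ((α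 ∘ ⇑τ) 1)).re / (w.1.embedding ((α ∘ ⇑τ) 0)).re) : ℝ) : ℂ), 1]) (det_rescale01_ne_zero h01s)) (formCongr_rescale01_map_diagonal L (α ∘ ⇑τ) w (fun i => hreal (τ i)) h01s))).continuous (ContinuousMulEquiv.restrictSubgroup (GLn.conjEquiv (Matrix.GeneralLinearGroup.mkOfDetNeZero (Matrix.diagonal ![((Real.sqrt ((w.1.embedding ((α ∘ ⇑τ) 0)).re / (w.1.embedding ((α ∘ ⇑τ) 1)).re) : ℝ) : ℂ), ((Real.sqrt ((w.1.embedding ((α ∘ ⇑τ) 1)).re / (w.1.embedding ((α ∘ ⇑τ) 0)).re) : ℝ) : ℂ), 1]) (det_rescale01_ne_zero h01s))) (archLocal L 3 (Matrix.diagonal (α ∘ ⇑τ)) w) (archLocal L 3 (Matrix.diagonal ((α ∘ ⇑τ) ∘ ⇑(Equiv.swap (0 : Fin 3) 1))) w) (mem_archLocal_diagonal_iff_conjEquiv_mem_of_formCongr_eq L 3 (α ∘ ⇑τ) ((α ∘ ⇑τ) ∘ ⇑(Equiv.swap (0 : Fin 3) 1)) w (Matrix.GeneralLinearGroup.mkOfDetNeZero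 (Matrix.diagonal ![((Real.sqrt ((w.1.embedding ((α ∘ ⇑τ) 0)).re / (w.1.embedding ((α ∘ ⇑τ) 1)).re) : ℝ) : ℂ), ((Real.sqrt ((w.1.embedding ((α ∘ ⇑τ) 1)).re / (w.1.embedding ((α ∘ ⇑τ) 0)).re) : ℝ) : ℂ), 1]) (det_rescale01_ne_zero h01s)) (formCongr_rescale01_map_diagonal L (α ∘ ⇑τ) w (fun i => hreal (τ i)) h01s))).symm.continuous))
    (ρZ : ∀ σ : Perm (Fin 3), Measure (Subgroup.centralizer ({(⟨circleDiagonal 3 (z0 ∘ ⇑σ), circleDiagonal_mem_archLocal_diagonal L 3 α w (z0 ∘ ⇑σ)⟩ : archLocal L 3 (Matrix.diagonal α) w)} : Set (archLocal L 3 (Matrix.diagonal α) w))))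
    (hρZ : ∀ (σ : Perm (Fin 3)), ¬ 0 < (w.1.embedding (α (σ⁻¹ 0))).re * (w.1.embedding (α (σ⁻¹ 2))).re →
      ρZ σ = (νH σ⁻¹).map (subgroupCongrHomeomorph (ContinuousMulEquiv.restrictSubgroup (GLn.conjEquiv (Matrix.GeneralLinearGroup.mkOfDetNeZero _ (det_monomial_one_ne_zero 3 σ⁻¹))) (archLocal L 3 (Matrix.diagonal (α ∘ ⇑σ⁻¹)) w) (archLocal L 3 (Matrix.diagonal α) w) (mem_archLocal_comp_perm_iff_conj_mem L 3 α w σ⁻¹)).toMulEquiv (Subgroup.centralizer ({(⟨circleDiagonal 3 z₁, circleDiagonal_mem_archLocal_diagonal L 3 (α ∘ ⇑σ⁻¹) w z₁⟩ : archLocal L 3 (Matrix.diagonal (α ∘ ⇑σ⁻¹)) w)} : Set (archLocal L 3 (Matrix.diagonal (α ∘ ⇑σ⁻¹)) w))) (Subgroup.centralizer ({(⟨circleDiagonal 3 (z0 ∘ ⇑σ), circleDiagonal_mem_archLocal_diagonal L 3 α w (z0 ∘ ⇑σ)⟩ : archLocal L 3 (Matrix.diagonal α) w)} : Set (archLocal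 L 3 (Matrix.diagonal α) w))) (relabel_inv_mem_centralizer_circleDiagonal_comp_iff L α w σ h02 h01 h02' h01') (ContinuousMulEquiv.restrictSubgroup (GLn.conjEquiv (Matrix.GeneralLinearGroup.mkOfDetNeZero _ (det_monomial_one_ne_zero 3 σ⁻¹))) (archLocal L 3 (Matrix.diagonal (α ∘ ⇑σ⁻¹)) w) (archLocal L 3 (Matrix.diagonal α) w) (mem_archLocal_comp_perm_iff_conj_mem L 3 α w σ⁻¹)).continuous (ContinuousMulEquiv.restrictSubgroup (GLn.conjEquiv (Matrix.GeneralLinearGroup.mkOfDetNeZero _ (det_monomial_one_ne_zero 3 σ⁻¹))) (archLocal L 3 (Matrix.diagonal (α ∘ ⇑σ⁻¹)) w) (archLocal L 3 (Matrix.diagonal α) w) (mem_archLocal_comp_perm_iff_conj_mem L 3 α w σ⁻¹)).symm.continuous))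
    (σ : Perm (Fin 3)) (hnc : (w.1.embedding (α (σ⁻¹ 0))).re * (w.1.embedding (α (σ⁻¹ 2))).re < 0) (h01s : 0 < (w.1.embedding ((α ∘ ⇑σ⁻¹) 0)).re * (w.1.embedding ((α ∘ ⇑σ⁻¹) 1)).re) :
    ∃ g₀ : archLocal L 3 (Matrix.diagonal α) w, ∃ hg₀ : (MulAut.conj g₀ : archLocal L 3 (Matrix.diagonal α) w ≃* archLocal L 3 (Matrix.diagonal α) w) (⟨circleDiagonal 3 (z0 ∘ ⇑σ), circleDiagonal_mem_archLocal_diagonal L 3 α w (z0 ∘ ⇑σ)⟩ : archLocal L 3 (Matrix.diagonal α) w) = (⟨circleDiagonal 3 (z0 ∘ ⇑((Equiv.swap (0 : Fin 3) 1) * σ)), circleDiagonal_mem_archLocal_diagonal L 3 α w (z0 ∘ ⇑((Equiv.swap (0 : Fin 3) 1) * σ))⟩ : archLocal L 3 (Matrix.diagonal α) w),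
      (ρZ σ).map (subgroupCongrHomeomorph (MulAut.conj g₀ : archLocal L 3 (Matrix.diagonal α) w ≃* archLocal L 3 (Matrix.diagonal α) w) (Subgroup.centralizer ({(⟨circleDiagonal 3 (z0 ∘ ⇑σ), circleDiagonal_mem_archLocal_diagonal L 3 α w (z0 ∘ ⇑σ)⟩ : archLocal L 3 (Matrix.diagonal α) w)} : Set (archLocal L 3 (Matrix.diagonal α) w))) (Subgroup.centralizer ({(⟨circleDiagonal 3 (z0 ∘ ⇑((Equiv.swap (0 : Fin 3) 1) * σ)), circleDiagonal_mem_archLocal_diagonal L 3 α w (z0 ∘ ⇑((Equiv.swap (0 : Fin 3) 1) * σ))⟩ : archLocal L 3 (Matrix.diagonal α) w)} : Set (archLocal L 3 (Matrix.diagonal α) w))) (forall_apply_mem_centralizer_singleton_iff_of_eq (MulAut.conj g₀ : archLocal L 3 (Matrix.diagonal α) w ≃* archLocal L 3 (Matrix.diagonal α) w) hg₀) (continuous_mulAutConj g₀) (continuous_mulAutConj_symm g₀)) = ρZ ((Equiv.swap (0 : Fin 3) 1) * σ) := by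
  have hncw : ¬ 0 < (w.1.embedding (α (σ⁻¹ 0))).re * (w.1.embedding (α (σ⁻¹ 2))).re := fun h => (lt_asymm hnc) h
  have e0 : ((Equiv.swap (0 : Fin 3) 1) * σ)⁻¹ 0 = σ⁻¹ 1 := by rw [Equiv.Perm.inv_eq_iff_eq]; simp
  have e2 : ((Equiv.swap (0 : Fin 3) 1) * σ)⁻¹ 2 = σ⁻¹ 2 := by rw [Equiv.Perm.inv_eq_iff_eq]; simp [Equiv.swap_apply_of_ne_of_ne]
  have hnc' : (w.1.embedding (α (((Equiv.swap (0 : Fin 3) 1) * σ)⁻¹ 0))).re * (w.1.embedding (α (((Equiv.swap (0 : Fin 3) 1) * σ)⁻¹ 2))).re < 0 := by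
    rw [e0, e2]
    have h3 : (w.1.embedding (α (σ⁻¹ 0))).re * (w.1.embedding (α (σ⁻¹ 0))).re * ((w.1.embedding (α (σ⁻¹ 1))).re * (w.1.embedding (α (σ⁻¹ 2))).re) < 0 := by
      have h4 := mul_neg_of_pos_of_neg h01s hnc
      calc (w.1.embedding (α (σ⁻¹ 0))).re * (w.1.embedding (α (σ⁻¹ 0))).re * ((w.1.embedding (α (σ⁻¹ 1))).re * (w.1.embedding (α (σ⁻¹ 2))).re)
          = (w.1.embedding (α (σ⁻¹ 0))).re * (w.1.embedding (α (σ⁻¹ 1))).re * ((w.1.embedding (α (σ⁻¹ 0))).re * (w.1.embedding (α (σ⁻¹ 2))).re) := by ring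
        _ < 0 := h4
    exact ((mul_neg_iff.1 h3).resolve_right fun h => (mul_self_nonneg _).not_gt h.1).2
  have hncw' : ¬ 0 < (w.1.embedding (α (((Equiv.swap (0 : Fin 3) 1) * σ)⁻¹ 0))).re * (w.1.embedding (α (((Equiv.swap (0 : Fin 3) 1) * σ)⁻¹ 2))).re := fun h => (lt_asymm hnc') h
  refine ⟨_, conj_relabel_rescale_relabel_inv_circleDiagonal_comp L α w hreal σ h01s z0, ?_⟩
  exact centralizer_measure_base_eq_of_rescale01 L α w hreal σ h01s h02 h01 h02' h01' (νH σ⁻¹) (νH ((Equiv.swap (0 : Fin 3) 1) * σ)⁻¹) (hT01 σ⁻¹ hnc h01s)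
    (ρZ σ) (hρZ σ hncw) (ρZ ((Equiv.swap (0 : Fin 3) 1) * σ)) (hρZ ((Equiv.swap (0 : Fin 3) 1) * σ) hncw')

/-! ## §3 The main theorem -/

/-- **THE PINNED CENTRALISER FAMILY OF ONE PLACE IS CONJUGATION-COHERENT.**  For every `σ₁ σ₂` and every `g ∈ G_w(α)` with `g·diag(z⁰∘σ₁)·g⁻¹ = diag(z⁰∘σ₂)`:
`(conj g|_Z)_* ρZ σ₁ = ρZ σ₂`.  [cite: Rogawski1990, §8.2 pp. 122–124; §3.7 Prop. 3.7.1] [cite: DeitmarEchterhoff2014, Thm. 1.5.3] -/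
theorem centralizer_measure_family_conj_coherent
    (hα : ∀ i, α i ≠ 0) (hreal : ∀ i, (w.1.embedding (α i)).im = 0)
    [MeasurableSpace (GL (Fin 3) ℂ)] [BorelSpace (GL (Fin 3) ℂ)]
    {z₁ z0 : Fin 3 → Circle} (h02 : z₁ 0 = z₁ 2) (h01 : z₁ 0 ≠ z₁ 1) (h02' : z0 0 = z0 2) (h01' : z0 0 ≠ z0 1)
    (νH : ∀ τ : Perm (Fin 3), Measure (Subgroup.centralizer ({(⟨circleDiagonal 3 z₁, circleDiagonal_mem_archLocal_diagonal L 3 (α ∘ ⇑τ) w z₁⟩ : archLocal L 3 (Matrix.diagonal (α ∘ ⇑τ)) w)} : Set (archLocal L 3 (Matrix.diagonal (α ∘ ⇑τ)) w))))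
    (hT02 : ∀ (τ : Perm (Fin 3)), (w.1.embedding (α (τ 0))).re * (w.1.embedding (α (τ 2))).re < 0 →
      νH τ = (νH (τ * Equiv.swap (0 : Fin 3) 2)).map (subgroupCongrHomeomorph (ContinuousMulEquiv.restrictSubgroup (GLn.conjEquiv (Matrix.GeneralLinearGroup.mkOfDetNeZero _ (det_monomial_one_ne_zero 3 (Equiv.swap (0 : Fin 3) 2)))) (archLocal L 3 (Matrix.diagonal ((α ∘ ⇑τ) ∘ ⇑(Equiv.swap (0 : Fin 3) 2))) w) (archLocal L 3 (Matrix.diagonal (α ∘ ⇑τ)) w) (mem_archLocal_comp_perm_iff_conj_mem L 3 (α ∘ ⇑τ) w (Equiv.swap (0 : Fin 3) 2))).toMulEquiv (Subgroup.centralizer ({(⟨circleDiagonal 3 z₁, circleDiagonal_mem_archLocal_diagonal L 3 ((α ∘ ⇑τ) ∘ ⇑(Equiv.swap (0 : Fin 3) 2)) w z₁⟩ : archLocal L 3 (Matrix.diagonal ((α ∘ ⇑τ) ∘ ⇑(Equiv.swap (0 : Fin 3) 2))) w)} : Set (archLocal L 3 (Matrix.diagonal ((α ∘ ⇑τ) ∘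 ⇑(Equiv.swap (0 : Fin 3) 2))) w))) (Subgroup.centralizer ({(⟨circleDiagonal 3 z₁, circleDiagonal_mem_archLocal_diagonal L 3 (α ∘ ⇑τ) w z₁⟩ : archLocal L 3 (Matrix.diagonal (α ∘ ⇑τ)) w)} : Set (archLocal L 3 (Matrix.diagonal (α ∘ ⇑τ)) w))) (forall_apply_mem_centralizer_singleton_iff_of_eq (ContinuousMulEquiv.restrictSubgroup (GLn.conjEquiv (Matrix.GeneralLinearGroup.mkOfDetNeZero _ (det_monomial_one_ne_zero 3 (Equiv.swap (0 : Fin 3) 2)))) (archLocal L 3 (Matrix.diagonal ((α ∘ ⇑τ) ∘ ⇑(Equiv.swap (0 : Fin 3) 2))) w) (archLocal L 3 (Matrix.diagonal (α ∘ ⇑τ)) w) (mem_archLocal_comp_perm_iff_conj_mem L 3 (α ∘ ⇑τ) w (Equiv.swap (0 : Fin 3) 2))).toMulEquiv ((relabel_circleDiagonal L 3 (α ∘ ⇑τ) w (Equiv.swap (0 : Fin 3) 2) z₁).trans (Subtype.ext (congrArg (circleDiagonal 3) (comp_swap02_symm_eq_self_of_wall z₁ h02))))) (ContinuousMulEquiv.restrictSubgroup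 (GLn.conjEquiv (Matrix.GeneralLinearGroup.mkOfDetNeZero _ (det_monomial_one_ne_zero 3 (Equiv.swap (0 : Fin 3) 2)))) (archLocal L 3 (Matrix.diagonal ((α ∘ ⇑τ) ∘ ⇑(Equiv.swap (0 : Fin 3) 2))) w) (archLocal L 3 (Matrix.diagonal (α ∘ ⇑τ)) w) (mem_archLocal_comp_perm_iff_conj_mem L 3 (α ∘ ⇑τ) w (Equiv.swap (0 : Fin 3) 2))).continuous (ContinuousMulEquiv.restrictSubgroup (GLn.conjEquiv (Matrix.GeneralLinearGroup.mkOfDetNeZero _ (det_monomial_one_ne_zero 3 (Equiv.swap (0 : Fin 3) 2)))) (archLocal L 3 (Matrix.diagonal ((α ∘ ⇑τ) ∘ ⇑(Equiv.swap (0 : Fin 3) 2))) w) (archLocal L 3 (Matrix.diagonal (α ∘ ⇑τ)) w) (mem_archLocal_comp_perm_iff_conj_mem L 3 (α ∘ ⇑τ) w (Equiv.swap (0 : Fin 3) 2))).symm.continuous))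
    (hT01 : ∀ (τ : Perm (Fin 3)), (w.1.embedding (α (τ 0))).re * (w.1.embedding (α (τ 2))).re < 0 →
      ∀ (h01s : 0 < (w.1.embedding ((α ∘ ⇑τ) 0)).re * (w.1.embedding ((α ∘ ⇑τ) 1)).re),
      νH (τ * Equiv.swap (0 : Fin 3) 1) = (νH τ).map (subgroupCongrHomeomorph (ContinuousMulEquiv.restrictSubgroup (GLn.conjEquiv (Matrix.GeneralLinearGroup.mkOfDetNeZero (Matrix.diagonal ![((Real.sqrt ((w.1.embedding ((α ∘ ⇑τ) 0)).re / (w.1.embedding ((α ∘ ⇑τ) 1)).re) : ℝ) : ℂ), ((Real.sqrt ((w.1.embedding ((α ∘ ⇑τ) 1)).re / (w.1.embedding ((α ∘ ⇑τ) 0)).re) : ℝ) : ℂ), 1]) (det_rescale01_ne_zero h01s))) (archLocal L 3 (Matrix.diagonal (α ∘ ⇑τ)) w) (archLocal L 3 (Matrix.diagonal ((α ∘ ⇑τ) ∘ ⇑(Equiv.swap (0 : Fin 3) 1))) w) (mem_archLocal_diagonal_iff_conjEquiv_mem_of_formCongr_eq L 3 (α ∘ ⇑τ) ((α ∘ ⇑τ)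 ∘ ⇑(Equiv.swap (0 : Fin 3) 1)) w (Matrix.GeneralLinearGroup.mkOfDetNeZero (Matrix.diagonal ![((Real.sqrt ((w.1.embedding ((α ∘ ⇑τ) 0)).re / (w.1.embedding ((α ∘ ⇑τ) 1)).re) : ℝ) : ℂ), ((Real.sqrt ((w.1.embedding ((α ∘ ⇑τ) 1)).re / (w.1.embedding ((α ∘ ⇑τ) 0)).re) : ℝ) : ℂ), 1]) (det_rescale01_ne_zero h01s)) (formCongr_rescale01_map_diagonal L (α ∘ ⇑τ) w (fun i => hreal (τ i)) h01s))).toMulEquiv (Subgroup.centralizer ({(⟨circleDiagonal 3 z₁, circleDiagonal_mem_archLocal_diagonal L 3 (α ∘ ⇑τ) w z₁⟩ : archLocal L 3 (Matrix.diagonal (α ∘ ⇑τ)) w)} : Set (archLocal L 3 (Matrix.diagonal (α ∘ ⇑τ)) w))) (Subgroup.centralizer ({(⟨circleDiagonal 3 z₁, circleDiagonal_mem_archLocal_diagonal L 3 ((α ∘ ⇑τ) ∘ ⇑(Equiv.swap (0 : Fin 3) 1)) w z₁⟩ : archLocal L 3 (Matrix.diagonal ((α ∘ ⇑τ) ∘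 ⇑(Equiv.swap (0 : Fin 3) 1))) w)} : Set (archLocal L 3 (Matrix.diagonal ((α ∘ ⇑τ) ∘ ⇑(Equiv.swap (0 : Fin 3) 1))) w))) (forall_apply_mem_centralizer_singleton_iff_of_eq (ContinuousMulEquiv.restrictSubgroup (GLn.conjEquiv (Matrix.GeneralLinearGroup.mkOfDetNeZero (Matrix.diagonal ![((Real.sqrt ((w.1.embedding ((α ∘ ⇑τ) 0)).re / (w.1.embedding ((α ∘ ⇑τ) 1)).re) : ℝ) : ℂ), ((Real.sqrt ((w.1.embedding ((α ∘ ⇑τ) 1)).re / (w.1.embedding ((α ∘ ⇑τ) 0)).re) : ℝ) : ℂ), 1]) (det_rescale01_ne_zero h01s))) (archLocal L 3 (Matrix.diagonal (α ∘ ⇑τ)) w) (archLocal L 3 (Matrix.diagonal ((α ∘ ⇑τ) ∘ ⇑(Equiv.swap (0 : Fin 3) 1))) w) (mem_archLocal_diagonal_iff_conjEquiv_mem_of_formCongr_eq L 3 (α ∘ ⇑τ) ((α ∘ ⇑τ) ∘ ⇑(Equiv.swap (0 : Fin 3) 1)) w (Matrix.GeneralLinearGroup.mkOfDetNeZero (Matrix.diagonal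 ![((Real.sqrt ((w.1.embedding ((α ∘ ⇑τ) 0)).re / (w.1.embedding ((α ∘ ⇑τ) 1)).re) : ℝ) : ℂ), ((Real.sqrt ((w.1.embedding ((α ∘ ⇑τ) 1)).re / (w.1.embedding ((α ∘ ⇑τ) 0)).re) : ℝ) : ℂ), 1]) (det_rescale01_ne_zero h01s)) (formCongr_rescale01_map_diagonal L (α ∘ ⇑τ) w (fun i => hreal (τ i)) h01s))).toMulEquiv (congrT_circleDiagonal L 3 (α ∘ ⇑τ) ((α ∘ ⇑τ) ∘ ⇑(Equiv.swap (0 : Fin 3) 1)) w (Matrix.GeneralLinearGroup.mkOfDetNeZero (Matrix.diagonal ![((Real.sqrt ((w.1.embedding ((α ∘ ⇑τ) 0)).re / (w.1.embedding ((α ∘ ⇑τ) 1)).re) : ℝ) : ℂ), ((Real.sqrt ((w.1.embedding ((α ∘ ⇑τ) 1)).re / (w.1.embedding ((α ∘ ⇑τ) 0)).re) : ℝ) : ℂ), 1]) (det_rescale01_ne_zero h01s)) (formCongr_rescale01_map_diagonal L (α ∘ ⇑τ) w (fun i => hreal (τ i)) h01s) (rescale01_conj_circleDiagonal L (α ∘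 ⇑τ) w h01s) z₁)) (ContinuousMulEquiv.restrictSubgroup (GLn.conjEquiv (Matrix.GeneralLinearGroup.mkOfDetNeZero (Matrix.diagonal ![((Real.sqrt ((w.1.embedding ((α ∘ ⇑τ) 0)).re / (w.1.embedding ((α ∘ ⇑τ) 1)).re) : ℝ) : ℂ), ((Real.sqrt ((w.1.embedding ((α ∘ ⇑τ) 1)).re / (w.1.embedding ((α ∘ ⇑τ) 0)).re) : ℝ) : ℂ), 1]) (det_rescale01_ne_zero h01s))) (archLocal L 3 (Matrix.diagonal (α ∘ ⇑τ)) w) (archLocal L 3 (Matrix.diagonal ((α ∘ ⇑τ) ∘ ⇑(Equiv.swap (0 : Fin 3) 1))) w) (mem_archLocal_diagonal_iff_conjEquiv_mem_of_formCongr_eq L 3 (α ∘ ⇑τ) ((α ∘ ⇑τ) ∘ ⇑(Equiv.swap (0 : Fin 3) 1)) w (Matrix.GeneralLinearGroup.mkOfDetNeZero (Matrix.diagonal ![((Real.sqrt ((w.1.embedding ((α ∘ ⇑τ) 0)).re / (w.1.embedding ((α ∘ ⇑τ) 1)).re) : ℝ) : ℂ), ((Real.sqrt ((w.1.embedding ((α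 ∘ ⇑τ) 1)).re / (w.1.embedding ((α ∘ ⇑τ) 0)).re) : ℝ) : ℂ), 1]) (det_rescale01_ne_zero h01s)) (formCongr_rescale01_map_diagonal L (α ∘ ⇑τ) w (fun i => hreal (τ i)) h01s))).continuous (ContinuousMulEquiv.restrictSubgroup (GLn.conjEquiv (Matrix.GeneralLinearGroup.mkOfDetNeZero (Matrix.diagonal ![((Real.sqrt ((w.1.embedding ((α ∘ ⇑τ) 0)).re / (w.1.embedding ((α ∘ ⇑τ) 1)).re) : ℝ) : ℂ), ((Real.sqrt ((w.1.embedding ((α ∘ ⇑τ) 1)).re / (w.1.embedding ((α ∘ ⇑τ) 0)).re) : ℝ) : ℂ), 1]) (det_rescale01_ne_zero h01s))) (archLocal L 3 (Matrix.diagonal (α ∘ ⇑τ)) w) (archLocal L 3 (Matrix.diagonal ((α ∘ ⇑τ) ∘ ⇑(Equiv.swap (0 : Fin 3) 1))) w) (mem_archLocal_diagonal_iff_conjEquiv_mem_of_formCongr_eq L 3 (α ∘ ⇑τ) ((α ∘ ⇑τ) ∘ ⇑(Equiv.swap (0 : Fin 3) 1)) w (Matrix.GeneralLinearGroup.mkOfDetNeZero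 (Matrix.diagonal ![((Real.sqrt ((w.1.embedding ((α ∘ ⇑τ) 0)).re / (w.1.embedding ((α ∘ ⇑τ) 1)).re) : ℝ) : ℂ), ((Real.sqrt ((w.1.embedding ((α ∘ ⇑τ) 1)).re / (w.1.embedding ((α ∘ ⇑τ) 0)).re) : ℝ) : ℂ), 1]) (det_rescale01_ne_zero h01s)) (formCongr_rescale01_map_diagonal L (α ∘ ⇑τ) w (fun i => hreal (τ i)) h01s))).symm.continuous))
    (ρZ : ∀ σ : Perm (Fin 3), Measure (Subgroup.centralizer ({(⟨circleDiagonal 3 (z0 ∘ ⇑σ), circleDiagonal_mem_archLocal_diagonal L 3 α w (z0 ∘ ⇑σ)⟩ : archLocal L 3 (Matrix.diagonal α) w)} : Set (archLocal L 3 (Matrix.diagonal α) w))))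
    (hρZ : ∀ (σ : Perm (Fin 3)), ¬ 0 < (w.1.embedding (α (σ⁻¹ 0))).re * (w.1.embedding (α (σ⁻¹ 2))).re →
      ρZ σ = (νH σ⁻¹).map (subgroupCongrHomeomorph (ContinuousMulEquiv.restrictSubgroup (GLn.conjEquiv (Matrix.GeneralLinearGroup.mkOfDetNeZero _ (det_monomial_one_ne_zero 3 σ⁻¹))) (archLocal L 3 (Matrix.diagonal (α ∘ ⇑σ⁻¹)) w) (archLocal L 3 (Matrix.diagonal α) w) (mem_archLocal_comp_perm_iff_conj_mem L 3 α w σ⁻¹)).toMulEquiv (Subgroup.centralizer ({(⟨circleDiagonal 3 z₁, circleDiagonal_mem_archLocal_diagonal L 3 (α ∘ ⇑σ⁻¹) w z₁⟩ : archLocal L 3 (Matrix.diagonal (α ∘ ⇑σ⁻¹)) w)} : Set (archLocal L 3 (Matrix.diagonal (α ∘ ⇑σ⁻¹)) w))) (Subgroup.centralizer ({(⟨circleDiagonal 3 (z0 ∘ ⇑σ), circleDiagonal_mem_archLocal_diagonal L 3 α w (z0 ∘ ⇑σ)⟩ : archLocal L 3 (Matrix.diagonal α) w)} : Set (archLocal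 L 3 (Matrix.diagonal α) w))) (relabel_inv_mem_centralizer_circleDiagonal_comp_iff L α w σ h02 h01 h02' h01') (ContinuousMulEquiv.restrictSubgroup (GLn.conjEquiv (Matrix.GeneralLinearGroup.mkOfDetNeZero _ (det_monomial_one_ne_zero 3 σ⁻¹))) (archLocal L 3 (Matrix.diagonal (α ∘ ⇑σ⁻¹)) w) (archLocal L 3 (Matrix.diagonal α) w) (mem_archLocal_comp_perm_iff_conj_mem L 3 α w σ⁻¹)).continuous (ContinuousMulEquiv.restrictSubgroup (GLn.conjEquiv (Matrix.GeneralLinearGroup.mkOfDetNeZero _ (det_monomial_one_ne_zero 3 σ⁻¹))) (archLocal L 3 (Matrix.diagonal (α ∘ ⇑σ⁻¹)) w) (archLocal L 3 (Matrix.diagonal α) w) (mem_archLocal_comp_perm_iff_conj_mem L 3 α w σ⁻¹)).symm.continuous))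
    (hρZi : ∀ σ, (ρZ σ).IsHaarMeasure ∧ (ρZ σ).IsInvInvariant)
    (hρZ1 : ∀ (σ : Perm (Fin 3)), 0 < (w.1.embedding (α (σ⁻¹ 0))).re * (w.1.embedding (α (σ⁻¹ 2))).re → ρZ σ Set.univ = 1) :
    ∀ (σ₁ σ₂ : Perm (Fin 3)) (g : archLocal L 3 (Matrix.diagonal α) w) (hg : (MulAut.conj g : archLocal L 3 (Matrix.diagonal α) w ≃* archLocal L 3 (Matrix.diagonal α) w) (⟨circleDiagonal 3 (z0 ∘ ⇑σ₁), circleDiagonal_mem_archLocal_diagonal L 3 α w (z0 ∘ ⇑σ₁)⟩ : archLocal L 3 (Matrix.diagonal α) w) = (⟨circleDiagonal 3 (z0 ∘ ⇑σ₂), circleDiagonal_mem_archLocal_diagonal L 3 α w (z0 ∘ ⇑σ₂)⟩ : archLocal L 3 (Matrix.diagonal α) w)),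
      (ρZ σ₁).map (subgroupCongrHomeomorph (MulAut.conj g : archLocal L 3 (Matrix.diagonal α) w ≃* archLocal L 3 (Matrix.diagonal α) w) (Subgroup.centralizer ({(⟨circleDiagonal 3 (z0 ∘ ⇑σ₁), circleDiagonal_mem_archLocal_diagonal L 3 α w (z0 ∘ ⇑σ₁)⟩ : archLocal L 3 (Matrix.diagonal α) w)} : Set (archLocal L 3 (Matrix.diagonal α) w))) (Subgroup.centralizer ({(⟨circleDiagonal 3 (z0 ∘ ⇑σ₂), circleDiagonal_mem_archLocal_diagonal L 3 α w (z0 ∘ ⇑σ₂)⟩ : archLocal L 3 (Matrix.diagonal α) w)} : Set (archLocal L 3 (Matrix.diagonal α) w))) (forall_apply_mem_centralizer_singleton_iff_of_eq (MulAut.conj g : archLocal L 3 (Matrix.diagonal α) w ≃* archLocal L 3 (Matrix.diagonal α) w) hg) (continuous_mulAutConj g) (continuous_mulAutConj_symm g)) = ρZ σ₂ := by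
  intro σ₁ σ₂ g hg
  haveI : LocallyCompactSpace (archLocal L 3 (Matrix.diagonal α) w) := locallyCompactSpace_archLocal L 3 (Matrix.diagonal α) w
  haveI : SecondCountableTopology (archLocal L 3 (Matrix.diagonal α) w) := secondCountableTopology_archLocal L 3 (Matrix.diagonal α) w
  have hx : ∀ i, (w.1.embedding (α i)).re ≠ 0 := re_embedding_ne_zero L 3 α w hα hreal
  haveI i1h : (ρZ σ₁).IsHaarMeasure := (hρZi σ₁).1
  haveI i1i : (ρZ σ₁).IsInvInvariant := (hρZi σ₁).2
  haveI i2h : (ρZ σ₂).IsHaarMeasure := (hρZi σ₂).1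
  -- homeomorphic centralisers: compactness of `Z(p₁)` iff of `Z(p₂)`
  have hiff : CompactSpace (Subgroup.centralizer ({(⟨circleDiagonal 3 (z0 ∘ ⇑σ₁), circleDiagonal_mem_archLocal_diagonal L 3 α w (z0 ∘ ⇑σ₁)⟩ : archLocal L 3 (Matrix.diagonal α) w)} : Set (archLocal L 3 (Matrix.diagonal α) w))) ↔ CompactSpace (Subgroup.centralizer ({(⟨circleDiagonal 3 (z0 ∘ ⇑σ₂), circleDiagonal_mem_archLocal_diagonal L 3 α w (z0 ∘ ⇑σ₂)⟩ : archLocal L 3 (Matrix.diagonal α) w)} : Set (archLocal L 3 (Matrix.diagonal α) w))) :=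
    ⟨fun h => @Homeomorph.compactSpace _ _ _ _ h (subgroupCongrHomeomorph (MulAut.conj g : archLocal L 3 (Matrix.diagonal α) w ≃* archLocal L 3 (Matrix.diagonal α) w) (Subgroup.centralizer ({(⟨circleDiagonal 3 (z0 ∘ ⇑σ₁), circleDiagonal_mem_archLocal_diagonal L 3 α w (z0 ∘ ⇑σ₁)⟩ : archLocal L 3 (Matrix.diagonal α) w)} : Set (archLocal L 3 (Matrix.diagonal α) w))) (Subgroup.centralizer ({(⟨circleDiagonal 3 (z0 ∘ ⇑σ₂), circleDiagonal_mem_archLocal_diagonal L 3 α w (z0 ∘ ⇑σ₂)⟩ : archLocal L 3 (Matrix.diagonal α) w)} : Set (archLocal L 3 (Matrix.diagonal α) w))) (forall_apply_mem_centralizer_singleton_iff_of_eq (MulAut.conj g : archLocal L 3 (Matrix.diagonal α) w ≃* archLocal L 3 (Matrix.diagonal α) w) hg) (continuous_mulAutConj g) (continuous_mulAutConj_symm g)),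
     fun h => @Homeomorph.compactSpace _ _ _ _ h (subgroupCongrHomeomorph (MulAut.conj g : archLocal L 3 (Matrix.diagonal α) w ≃* archLocal L 3 (Matrix.diagonal α) w) (Subgroup.centralizer ({(⟨circleDiagonal 3 (z0 ∘ ⇑σ₁), circleDiagonal_mem_archLocal_diagonal L 3 α w (z0 ∘ ⇑σ₁)⟩ : archLocal L 3 (Matrix.diagonal α) w)} : Set (archLocal L 3 (Matrix.diagonal α) w))) (Subgroup.centralizer ({(⟨circleDiagonal 3 (z0 ∘ ⇑σ₂), circleDiagonal_mem_archLocal_diagonal L 3 α w (z0 ∘ ⇑σ₂)⟩ : archLocal L 3 (Matrix.diagonal α) w)} : Set (archLocal L 3 (Matrix.diagonal α) w))) (forall_apply_mem_centralizer_singleton_iff_of_eq (MulAut.conj g : archLocal L 3 (Matrix.diagonal α) w ≃* archLocal L 3 (Matrix.diagonal α) w) hg) (continuous_mulAutConj g) (continuous_mulAutConj_symm g)).symm⟩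
  -- compactness of `Z(p_σ)` iff `σ` is a compact wall
  have hcpt : ∀ σ : Perm (Fin 3), 0 < (w.1.embedding (α (σ⁻¹ 0))).re * (w.1.embedding (α (σ⁻¹ 2))).re → CompactSpace (Subgroup.centralizer ({(⟨circleDiagonal 3 (z0 ∘ ⇑σ), circleDiagonal_mem_archLocal_diagonal L 3 α w (z0 ∘ ⇑σ)⟩ : archLocal L 3 (Matrix.diagonal α) w)} : Set (archLocal L 3 (Matrix.diagonal α) w))) := fun σ h =>
    isCompact_iff_compactSpace.1 (isCompact_centralizer_circleDiagonal_comp_of_pos L α w hα hreal σ h h02' h01')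
  have hncp : ∀ σ : Perm (Fin 3), ¬ 0 < (w.1.embedding (α (σ⁻¹ 0))).re * (w.1.embedding (α (σ⁻¹ 2))).re → ¬ CompactSpace (Subgroup.centralizer ({(⟨circleDiagonal 3 (z0 ∘ ⇑σ), circleDiagonal_mem_archLocal_diagonal L 3 α w (z0 ∘ ⇑σ)⟩ : archLocal L 3 (Matrix.diagonal α) w)} : Set (archLocal L 3 (Matrix.diagonal α) w))) := by
    intro σ h hK
    have hlt : (w.1.embedding (α (σ⁻¹ 0))).re * (w.1.embedding (α (σ⁻¹ 2))).re < 0 := lt_of_le_of_ne (not_lt.1 h) (mul_ne_zero (hx _) (hx _))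
    have hnc := not_compactSpace_centralizer_circleDiagonal_noncompactWall L (α ∘ ⇑σ⁻¹) w (fun i => hreal (σ⁻¹ i)) hlt h02 h01
    exact hnc (@Homeomorph.compactSpace _ _ _ _ hK (subgroupCongrHomeomorph (ContinuousMulEquiv.restrictSubgroup (GLn.conjEquiv (Matrix.GeneralLinearGroup.mkOfDetNeZero _ (det_monomial_one_ne_zero 3 σ⁻¹))) (archLocal L 3 (Matrix.diagonal (α ∘ ⇑σ⁻¹)) w) (archLocal L 3 (Matrix.diagonal α) w) (mem_archLocal_comp_perm_iff_conj_mem L 3 α w σ⁻¹)).toMulEquiv (Subgroup.centralizer ({(⟨circleDiagonal 3 z₁, circleDiagonal_mem_archLocal_diagonal L 3 (α ∘ ⇑σ⁻¹) w z₁⟩ : archLocal L 3 (Matrix.diagonal (α ∘ ⇑σ⁻¹)) w)} : Set (archLocal L 3 (Matrix.diagonal (α ∘ ⇑σ⁻¹)) w))) (Subgroup.centralizer ({(⟨circleDiagonal 3 (z0 ∘ ⇑σ), circleDiagonal_mem_archLocal_diagonal L 3 α w (z0 ∘ ⇑σ)⟩ : archLocal L 3 (Matrix.diagonal α) w)} :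 Set (archLocal L 3 (Matrix.diagonal α) w))) (relabel_inv_mem_centralizer_circleDiagonal_comp_iff L α w σ h02 h01 h02' h01') (ContinuousMulEquiv.restrictSubgroup (GLn.conjEquiv (Matrix.GeneralLinearGroup.mkOfDetNeZero _ (det_monomial_one_ne_zero 3 σ⁻¹))) (archLocal L 3 (Matrix.diagonal (α ∘ ⇑σ⁻¹)) w) (archLocal L 3 (Matrix.diagonal α) w) (mem_archLocal_comp_perm_iff_conj_mem L 3 α w σ⁻¹)).continuous (ContinuousMulEquiv.restrictSubgroup (GLn.conjEquiv (Matrix.GeneralLinearGroup.mkOfDetNeZero _ (det_monomial_one_ne_zero 3 σ⁻¹))) (archLocal L 3 (Matrix.diagonal (α ∘ ⇑σ⁻¹)) w) (archLocal L 3 (Matrix.diagonal α) w) (mem_archLocal_comp_perm_iff_conj_mem L 3 α w σ⁻¹)).symm.continuous).symm)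
  by_cases h1 : 0 < (w.1.embedding (α (σ₁⁻¹ 0))).re * (w.1.embedding (α (σ₁⁻¹ 2))).re
  · by_cases h2 : 0 < (w.1.embedding (α (σ₂⁻¹ 0))).re * (w.1.embedding (α (σ₂⁻¹ 2))).re
    · -- compact ∕ compact: probability Haar measures correspond
      exact map_subgroupCongrHomeomorph_conj_eq_of_measure_univ_eq_one _ _ g hg (isClosed_coe_centralizer_singleton _) (isClosed_coe_centralizer_singleton _)
        (ρZ σ₁) (hρZ1 σ₁ h1) (ρZ σ₂) (hρZ1 σ₂ h2)
    · exact absurd (hiff.1 (hcpt σ₁ h1)) (hncp σ₂ h2)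
  · by_cases h2 : 0 < (w.1.embedding (α (σ₂⁻¹ 0))).re * (w.1.embedding (α (σ₂⁻¹ 2))).re
    · exact absurd (hiff.2 (hcpt σ₂ h2)) (hncp σ₁ h1)
    · -- noncompact ∕ noncompact: a chain of link steps, then `coh_of_exists`
      have hn1 : (w.1.embedding (α (σ₁⁻¹ 0))).re * (w.1.embedding (α (σ₁⁻¹ 2))).re < 0 := lt_of_le_of_ne (not_lt.1 h1) (mul_ne_zero (hx _) (hx _))
      have hn2 : (w.1.embedding (α (σ₂⁻¹ 0))).re * (w.1.embedding (α (σ₂⁻¹ 2))).re < 0 := lt_of_le_of_ne (not_lt.1 h2) (mul_ne_zero (hx _) (hx _))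
      refine coh_of_exists L α w (ρZ σ₁) (ρZ σ₂) ?_ g hg
      -- Boolean signs and the link graph
      set s : Fin 3 → Bool := fun i => decide (0 < (w.1.embedding (α i)).re) with hs
      have hN : ∀ a b : Fin 3, (w.1.embedding (α (a))).re * (w.1.embedding (α (b))).re < 0 ↔ s a ≠ s b := fun a b => by
        rw [mul_neg_iff_not_pos_iff_pos (hx a) (hx b), hs]; simp only [ne_eq, decide_eq_decide]
      have hP : ∀ a b : Fin 3, 0 < (w.1.embedding (α (a))).re * (w.1.embedding (α (b))).re ↔ s a = s b := fun a b => by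
        rw [mul_pos_iff_pos_iff_pos (hx a) (hx b), hs]; simp only [decide_eq_decide]
      -- steps (with their sign conditions in Boolean form)
      have S02 : ∀ σ : Perm (Fin 3), s (σ⁻¹ 0) ≠ s (σ⁻¹ 2) → ∃ g₀ : archLocal L 3 (Matrix.diagonal α) w, ∃ hg₀ : (MulAut.conj g₀ : archLocal L 3 (Matrix.diagonal α) w ≃* archLocal L 3 (Matrix.diagonal α) w) (⟨circleDiagonal 3 (z0 ∘ ⇑σ), circleDiagonal_mem_archLocal_diagonal L 3 α w (z0 ∘ ⇑σ)⟩ : archLocal L 3 (Matrix.diagonal α) w) = (⟨circleDiagonal 3 (z0 ∘ ⇑((Equiv.swap (0 : Fin 3) 2) * σ)), circleDiagonal_mem_archLocal_diagonal L 3 α w (z0 ∘ ⇑((Equiv.swap (0 : Fin 3) 2) * σ))⟩ : archLocal L 3 (Matrix.diagonal α) w),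
      (ρZ σ).map (subgroupCongrHomeomorph (MulAut.conj g₀ : archLocal L 3 (Matrix.diagonal α) w ≃* archLocal L 3 (Matrix.diagonal α) w) (Subgroup.centralizer ({(⟨circleDiagonal 3 (z0 ∘ ⇑σ), circleDiagonal_mem_archLocal_diagonal L 3 α w (z0 ∘ ⇑σ)⟩ : archLocal L 3 (Matrix.diagonal α) w)} : Set (archLocal L 3 (Matrix.diagonal α) w))) (Subgroup.centralizer ({(⟨circleDiagonal 3 (z0 ∘ ⇑((Equiv.swap (0 : Fin 3) 2) * σ)), circleDiagonal_mem_archLocal_diagonal L 3 α w (z0 ∘ ⇑((Equiv.swap (0 : Fin 3) 2) * σ))⟩ : archLocal L 3 (Matrix.diagonal α) w)} : Set (archLocal L 3 (Matrix.diagonal α) w))) (forall_apply_mem_centralizer_singleton_iff_of_eq (MulAut.conj g₀ : archLocal L 3 (Matrix.diagonal α) w ≃* archLocal L 3 (Matrix.diagonal α) w) hg₀) (continuous_mulAutConj g₀) (continuous_mulAutConj_symm g₀)) = ρZ ((Equiv.swap (0 : Fin 3) 2) * σ) :=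
        fun σ h => coh_step_swap02 L α w h02 h01 h02' h01' νH hT02 ρZ hρZ σ ((hN _ _).2 h)
      have S01 : ∀ σ : Perm (Fin 3), s (σ⁻¹ 0) ≠ s (σ⁻¹ 2) → s (σ⁻¹ 0) = s (σ⁻¹ 1) →
          ∃ g₀ : archLocal L 3 (Matrix.diagonal α) w, ∃ hg₀ : (MulAut.conj g₀ : archLocal L 3 (Matrix.diagonal α) w ≃* archLocal L 3 (Matrix.diagonal α) w) (⟨circleDiagonal 3 (z0 ∘ ⇑σ), circleDiagonal_mem_archLocal_diagonal L 3 α w (z0 ∘ ⇑σ)⟩ : archLocal L 3 (Matrix.diagonal α) w) = (⟨circleDiagonal 3 (z0 ∘ ⇑((Equiv.swap (0 : Fin 3) 1) * σ)), circleDiagonal_mem_archLocal_diagonal L 3 α w (z0 ∘ ⇑((Equiv.swap (0 : Fin 3) 1) * σ))⟩ : archLocal L 3 (Matrix.diagonal α) w),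
      (ρZ σ).map (subgroupCongrHomeomorph (MulAut.conj g₀ : archLocal L 3 (Matrix.diagonal α) w ≃* archLocal L 3 (Matrix.diagonal α) w) (Subgroup.centralizer ({(⟨circleDiagonal 3 (z0 ∘ ⇑σ), circleDiagonal_mem_archLocal_diagonal L 3 α w (z0 ∘ ⇑σ)⟩ : archLocal L 3 (Matrix.diagonal α) w)} : Set (archLocal L 3 (Matrix.diagonal α) w))) (Subgroup.centralizer ({(⟨circleDiagonal 3 (z0 ∘ ⇑((Equiv.swap (0 : Fin 3) 1) * σ)), circleDiagonal_mem_archLocal_diagonal L 3 α w (z0 ∘ ⇑((Equiv.swap (0 : Fin 3) 1) * σ))⟩ : archLocal L 3 (Matrix.diagonal α) w)} : Set (archLocal L 3 (Matrix.diagonal α) w))) (forall_apply_mem_centralizer_singleton_iff_of_eq (MulAut.conj g₀ : archLocal L 3 (Matrix.diagonal α) w ≃* archLocal L 3 (Matrix.diagonal α) w) hg₀) (continuous_mulAutConj g₀) (continuous_mulAutConj_symm g₀)) = ρZ ((Equiv.swap (0 : Fin 3) 1) * σ) :=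
        fun σ h h' => coh_step_rescale01 L α w hreal h02 h01 h02' h01' νH hT01 ρZ hρZ σ ((hN _ _).2 h) ((hP _ _).2 h')
      -- index bookkeeping for the moved permutations
      have i02_0 : ∀ ρ : Perm (Fin 3), ((Equiv.swap (0 : Fin 3) 2) * ρ)⁻¹ 0 = ρ⁻¹ 2 := fun ρ => by rw [Equiv.Perm.inv_eq_iff_eq]; simp
      have i02_1 : ∀ ρ : Perm (Fin 3), ((Equiv.swap (0 : Fin 3) 2) * ρ)⁻¹ 1 = ρ⁻¹ 1 := fun ρ => by
        rw [Equiv.Perm.inv_eq_iff_eq]; simp [Equiv.swap_apply_of_ne_of_ne]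
      have i02_2 : ∀ ρ : Perm (Fin 3), ((Equiv.swap (0 : Fin 3) 2) * ρ)⁻¹ 2 = ρ⁻¹ 0 := fun ρ => by rw [Equiv.Perm.inv_eq_iff_eq]; simp
      have i01_0 : ∀ ρ : Perm (Fin 3), ((Equiv.swap (0 : Fin 3) 1) * ρ)⁻¹ 0 = ρ⁻¹ 1 := fun ρ => by rw [Equiv.Perm.inv_eq_iff_eq]; simp
      have i01_2 : ∀ ρ : Perm (Fin 3), ((Equiv.swap (0 : Fin 3) 1) * ρ)⁻¹ 2 = ρ⁻¹ 2 := fun ρ => by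
        rw [Equiv.Perm.inv_eq_iff_eq]; simp [Equiv.swap_apply_of_ne_of_ne]
      have n1 : s (σ₁⁻¹ 0) ≠ s (σ₁⁻¹ 2) := (hN _ _).1 hn1
      -- `σ₂ = word · σ₁` from the link graph (stated on the frames `τ = σ⁻¹`)
      have key := nc_closure_bool s σ₁⁻¹ σ₂⁻¹ n1 ((hN _ _).1 hn2)
      have inv_eq : ∀ {ρ π : Perm (Fin 3)}, ρ⁻¹ = π → ρ = π⁻¹ := fun {ρ π} h => by rw [← h, inv_inv]
      rcases key with h | h | ⟨hs01, h | h⟩ | ⟨hs21, h | h⟩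
      · -- σ₂ = σ₁
        have e : σ₂ = σ₁ := inv_injective h
        subst e
        refine ⟨1, by rw [map_one, MulAut.one_apply], ?_⟩
        rw [show (⇑(subgroupCongrHomeomorph (MulAut.conj 1 : archLocal L 3 (Matrix.diagonal α) w ≃* archLocal L 3 (Matrix.diagonal α) w) (Subgroup.centralizer ({(⟨circleDiagonal 3 (z0 ∘ ⇑σ₂), circleDiagonal_mem_archLocal_diagonal L 3 α w (z0 ∘ ⇑σ₂)⟩ : archLocal L 3 (Matrix.diagonal α) w)} : Set (archLocal L 3 (Matrix.diagonal α) w))) (Subgroup.centralizer ({(⟨circleDiagonal 3 (z0 ∘ ⇑σ₂), circleDiagonal_mem_archLocal_diagonal L 3 α w (z0 ∘ ⇑σ₂)⟩ : archLocal L 3 (Matrix.diagonal α) w)} : Set (archLocal L 3 (Matrix.diagonal α) w))) (forall_apply_mem_centralizer_singleton_iff_of_eq (MulAut.conj 1 : archLocal L 3 (Matrix.diagonal α) w ≃* archLocal L 3 (Matrix.diagonal α) w) (by rw [map_one, MulAut.one_apply])) (continuous_mulAutConj 1) (continuous_mulAutConj_symm 1)) : Subgroup.centralizer ({(⟨circleDiagonal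 3 (z0 ∘ ⇑σ₂), circleDiagonal_mem_archLocal_diagonal L 3 α w (z0 ∘ ⇑σ₂)⟩ : archLocal L 3 (Matrix.diagonal α) w)} : Set (archLocal L 3 (Matrix.diagonal α) w)) → Subgroup.centralizer ({(⟨circleDiagonal 3 (z0 ∘ ⇑σ₂), circleDiagonal_mem_archLocal_diagonal L 3 α w (z0 ∘ ⇑σ₂)⟩ : archLocal L 3 (Matrix.diagonal α) w)} : Set (archLocal L 3 (Matrix.diagonal α) w))) = id from ?_, Measure.map_id]
        funext x
        apply Subtype.ext; apply Subtype.ext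
        simp only [coe_subgroupCongrHomeomorph_apply, MulAut.conj_apply, one_mul, inv_one, mul_one, id]
      · -- σ₂ = (0 2)·σ₁
        have e : σ₂ = (Equiv.swap (0 : Fin 3) 2) * σ₁ := by
          have := inv_eq h; rwa [_root_.mul_inv_rev, Equiv.swap_inv, inv_inv] at this
        subst e
        exact S02 σ₁ n1
      · -- σ₂ = (0 1)·σ₁
        have e : σ₂ = (Equiv.swap (0 : Fin 3) 1) * σ₁ := by
          have := inv_eq h; rwa [_root_.mul_inv_rev, Equiv.swap_inv, inv_inv] at this
        subst e
        exact S01 σ₁ n1 hs01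
      · -- σ₂ = (0 2)·(0 1)·σ₁
        have e : σ₂ = (Equiv.swap (0 : Fin 3) 2) * ((Equiv.swap (0 : Fin 3) 1) * σ₁) := by
          have := inv_eq h; rwa [_root_.mul_inv_rev, _root_.mul_inv_rev, Equiv.swap_inv, Equiv.swap_inv, inv_inv, ← mul_assoc] at this
        subst e
        refine coh_trans L α w _ _ _ (S01 σ₁ n1 hs01) (S02 ((Equiv.swap (0 : Fin 3) 1) * σ₁) ?_)
        rw [i01_0, i01_2]; exact fun h' => n1 (hs01.trans h')
      · -- σ₂ = (0 1)·(0 2)·σ₁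
        have e : σ₂ = (Equiv.swap (0 : Fin 3) 1) * ((Equiv.swap (0 : Fin 3) 2) * σ₁) := by
          have := inv_eq h; rwa [_root_.mul_inv_rev, _root_.mul_inv_rev, Equiv.swap_inv, Equiv.swap_inv, inv_inv, ← mul_assoc] at this
        subst e
        refine coh_trans L α w _ _ _ (S02 σ₁ n1) (S01 ((Equiv.swap (0 : Fin 3) 2) * σ₁) ?_ ?_)
        · rw [i02_0, i02_2]; exact fun h' => n1 h'.symm
        · rw [i02_0, i02_1]; exact hs21
      · -- σ₂ = (0 2)·(0 1)·(0 2)·σ₁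
        have e : σ₂ = (Equiv.swap (0 : Fin 3) 2) * ((Equiv.swap (0 : Fin 3) 1) * ((Equiv.swap (0 : Fin 3) 2) * σ₁)) := by
          have := inv_eq h
          rwa [_root_.mul_inv_rev, _root_.mul_inv_rev, _root_.mul_inv_rev, Equiv.swap_inv, Equiv.swap_inv, inv_inv, ← mul_assoc, ← mul_assoc] at this
        subst e
        refine coh_trans L α w _ _ _ (S02 σ₁ n1) (coh_trans L α w _ _ _ (S01 ((Equiv.swap (0 : Fin 3) 2) * σ₁) ?_ ?_) (S02 ((Equiv.swap (0 : Fin 3) 1) * ((Equiv.swap (0 : Fin 3) 2) * σ₁)) ?_))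
        · rw [i02_0, i02_2]; exact fun h' => n1 h'.symm
        · rw [i02_0, i02_1]; exact hs21
        · rw [i01_0, i01_2, i02_1, i02_2]; exact fun h' => n1 (h'.symm.trans hs21.symm ▸ rfl : s (σ₁⁻¹ 0) = s (σ₁⁻¹ 2))

end Coherence

end Literature.NumberTheory.Rogawski1990

end
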